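import Mathlib.Algebra.Ring.Basic
import Mathlib.Tactic.LinearCombination
import Mathlib.Algebra.GroupWithZero.Basic
import Mathlib.Tactic.Ring
import HarnessLib

/-!
# Alper–Bogart–Velasco 2017, §1: `codim Sing(perm_4) ≥ 7` — the scalar case analysis

Fourth file of the series (framing: `ABV17SingPermFourPrelim.lean`).  Pure algebra in a
commutative domain with `2 ≠ 0`: the residual case of the pivot analysis.  A `4 × 4` point with
vanishing `3 × 3` subpermanents and pivot `g = ad + bc ≠ 0` on `TL = (a b; c d)` carries
`TR = (p p'; q q')` (tops of the right columns `2, 3`), `BL = (s t; s' t')` (lefts of the bottom rows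
`2, 3`) and the derived quantities `U₀₂ = aq + pc`, `U₀₃ = aq' + p'c`, `U₁₂ = bq + pd`, `U₁₃ = bq' + p'd`,
`U'₀₂ = at + sb`, `U'₀₃ = at' + s'b`, `U'₁₂ = ct + sd`, `U'₁₃ = ct' + s'd`, `D = ab qq' + pp' cd`,
`D' = ac tt' + ss' bd`; the ideal of `3 × 3` subpermanents contains `E_i = a_{i0} D + a_{i1} U₀₂U₀₃`,
`F_i = a_{i1} D + a_{i0} U₁₂U₁₃` and their transposes `E'_j, F'_j`.  When `D = D' = 0` and no right
column has zero top and no bottom row has zero left, the point has three further zero coordinates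
among the twelve entries of `TL ∪ TR ∪ BL` (`three_zeros_of_U_ne_zero`, `three_zeros_of_split`),
or is contradictory (`false_of_same`).  Each lemma is stated once over named scalars and is
instantiated in the assembly under the symmetries column `0 ↔ 1`, column `2 ↔ 3`, row `2 ↔ 3`,
transpose.

Honest framing: dictionary work (von zur Gathen's problem at `k = 4`); VP ≠ VNP is NOT proved.

## References
* J. Alper, T. Bogart, M. Velasco, Found. Comput. Math. 17 (2017), arXiv:1505.02205, §1 p0003 L38
  ("it can be readily computed that … `codim(Sing(perm_4)) = 8`"). [AlperBogartVelasco2017]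
-/

namespace Literature.Computability.AlgebraicComplexity

namespace AlperBogartVelasco

variable {L : Type*} [CommRing L] [IsDomain L]

/-- **Residual case, a product `U₀₂U₀₃ ≠ 0`.**  From `E₂ = E₃ = 0` with `D = 0`: `t = t' = 0`;
then `U'₀ᵢ = s_i b`, `U'₁ᵢ = s_i d`, and `E'₂ = F'₂ = 0` with `D' = 0` force `qb = pd = 0`, whence
`b = 0` or `d = 0` since `(p, q) ≠ 0`: three zero coordinates `t, t'` and `b` or `d`.
[cite: AlperBogartVelasco2017, §1 (sentence introducing Cor. 1.4), arXiv text p0003 L38] -/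
theorem three_zeros_of_U_ne_zero {a b c d p q p' q' s t s' t' : L}
    (hU : (a * q + p * c) * (a * q' + p' * c) ≠ 0)
    (hD : a * b * q * q' + p * p' * c * d = 0)
    (hD' : a * c * t * t' + s * s' * b * d = 0)
    (hE2 : s * (a * b * q * q' + p * p' * c * d) + t * ((a * q + p * c) * (a * q' + p' * c)) = 0)
    (hE3 : s' * (a * b * q * q' + p * p' * c * d) + t' * ((a * q + p * c) * (a * q' + p' * c)) = 0)
    (hE'2 : p * (a * c * t * t' + s * s' * b * d) + q * ((a * t + s * b) * (a * t' + s' * b)) = 0)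
    (hF'2 : q * (a * c * t * t' + s * s' * b * d) + p * ((c * t + s * d) * (c * t' + s' * d)) = 0)
    (hr2 : ¬ (s = 0 ∧ t = 0)) (hr3 : ¬ (s' = 0 ∧ t' = 0)) (hc2 : ¬ (p = 0 ∧ q = 0)) :
    t = 0 ∧ t' = 0 ∧ (b = 0 ∨ d = 0) := by
  rw [hD, mul_zero, zero_add] at hE2 hE3
  have ht : t = 0 := (mul_eq_zero.1 hE2).resolve_right hU
  have ht' : t' = 0 := (mul_eq_zero.1 hE3).resolve_right hU
  have hs : s ≠ 0 := fun h => hr2 ⟨h, ht⟩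
  have hs' : s' ≠ 0 := fun h => hr3 ⟨h, ht'⟩
  rw [hD', mul_zero, zero_add, ht, ht'] at hE'2 hF'2
  refine ⟨ht, ht', ?_⟩
  by_contra hbd
  push Not at hbd
  obtain ⟨hb, hd⟩ := hbd
  have hq : q = 0 := by
    have h : q * (b * b) * (s * s') = 0 := by linear_combination hE'2
    simpa [mul_eq_zero, hb, hs, hs'] using h
  have hp : p = 0 := by
    have h : p * (d * d) * (s * s') = 0 := by linear_combination hF'2
    simpa [mul_eq_zero, hd, hs, hs'] using h
  exact hc2 ⟨hp, hq⟩

/-- **Residual case, split columns** (`U₀₂ = 0`, `U₁₃ = 0`): then `D = 2 pp'cd = 2 ab qq'`, so with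
`2 ≠ 0` one of `c, d, p, p'` vanishes, and in each case `g ≠ 0`, the vanishing `U` and `D' = 0`
produce two more zeros among `TL ∪ TR ∪ BL`.
[cite: AlperBogartVelasco2017, §1 (sentence introducing Cor. 1.4), arXiv text p0003 L38] -/
theorem three_zeros_of_split {a b c d p q p' q' s t s' t' : L} (h2 : (2 : L) ≠ 0)
    (hg : a * d + b * c ≠ 0)
    (hU02 : a * q + p * c = 0) (hU13 : b * q' + p' * d = 0)
    (hD : a * b * q * q' + p * p' * c * d = 0)
    (hD' : a * c * t * t' + s * s' * b * d = 0)
    (hc2 : ¬ (p = 0 ∧ q = 0)) (hc3 : ¬ (p' = 0 ∧ q' = 0)) :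
    (c = 0 ∧ q = 0 ∧ (b = 0 ∨ s = 0 ∨ s' = 0)) ∨ (d = 0 ∧ q' = 0 ∧ (a = 0 ∨ t = 0 ∨ t' = 0)) ∨
      (p = 0 ∧ a = 0 ∧ (d = 0 ∨ s = 0 ∨ s' = 0)) ∨ (p' = 0 ∧ b = 0 ∧ (c = 0 ∨ t = 0 ∨ t' = 0)) := by
  have h2D : 2 * (p * p' * c * d) = 0 := by
    have e1 : a * q = -(p * c) := by linear_combination hU02
    have e2 : b * q' = -(p' * d) := by linear_combination hU13
    have : a * b * q * q' = p * p' * c * d := by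
      linear_combination (b * q') * e1 - (p * c) * e2
    linear_combination hD - this
  have hprod : p * p' * c * d = 0 := (mul_eq_zero.1 h2D).resolve_left h2
  rcases mul_eq_zero.1 hprod with h | hd0
  · rcases mul_eq_zero.1 h with h | hc0
    · rcases mul_eq_zero.1 h with hp0 | hp0'
      · -- `p = 0`
        have hq : q ≠ 0 := fun hq => hc2 ⟨hp0, hq⟩
        have ha : a = 0 := by
          rw [hp0, zero_mul, add_zero] at hU02
          exact (mul_eq_zero.1 hU02).resolve_right hq
        have hb : b ≠ 0 := by
          intro hb; apply hg; rw [ha, hb]; ring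
        have h3 : d * s * s' = 0 := by
          have : s * s' * b * d = 0 := by rw [ha] at hD'; simpa using hD'
          have : b * (d * s * s') = 0 := by linear_combination this
          exact (mul_eq_zero.1 this).resolve_left hb
        refine Or.inr (Or.inr (Or.inl ⟨hp0, ha, ?_⟩))
        rcases mul_eq_zero.1 h3 with h | h
        · rcases mul_eq_zero.1 h with h | h
          · exact Or.inl h
          · exact Or.inr (Or.inl h)
        · exact Or.inr (Or.inr h)
      · -- `p' = 0`
        have hq' : q' ≠ 0 := fun hq' => hc3 ⟨hp0', hq'⟩
        have hb : b = 0 := by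
          rw [hp0', zero_mul, add_zero] at hU13
          exact (mul_eq_zero.1 hU13).resolve_right hq'
        have ha : a ≠ 0 := by
          intro ha; apply hg; rw [ha, hb]; ring
        have h3 : c * t * t' = 0 := by
          have : a * c * t * t' = 0 := by rw [hb] at hD'; simpa using hD'
          have : a * (c * t * t') = 0 := by linear_combination this
          exact (mul_eq_zero.1 this).resolve_left ha
        refine Or.inr (Or.inr (Or.inr ⟨hp0', hb, ?_⟩))
        rcases mul_eq_zero.1 h3 with h | h
        · rcases mul_eq_zero.1 h with h | h
          · exact Or.inl h
          · exact Or.inr (Or.inl h)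
        · exact Or.inr (Or.inr h)
    · -- `c = 0`
      have ha : a ≠ 0 := by
        intro ha; apply hg; rw [ha, hc0]; ring
      have hd : d ≠ 0 := by
        intro hd; apply hg; rw [hd, hc0]; ring
      have hq : q = 0 := by
        rw [hc0, mul_zero, add_zero] at hU02
        exact (mul_eq_zero.1 hU02).resolve_left ha
      have h3 : b * s * s' = 0 := by
        have : s * s' * b * d = 0 := by rw [hc0] at hD'; simpa using hD'
        have : d * (b * s * s') = 0 := by linear_combination this
        exact (mul_eq_zero.1 this).resolve_left hd
      refine Or.inl ⟨hc0, hq, ?_⟩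
      rcases mul_eq_zero.1 h3 with h | h
      · rcases mul_eq_zero.1 h with h | h
        · exact Or.inl h
        · exact Or.inr (Or.inl h)
      · exact Or.inr (Or.inr h)
  · -- `d = 0`
    have hb : b ≠ 0 := by
      intro hb; apply hg; rw [hb, hd0]; ring
    have hc : c ≠ 0 := by
      intro hc; apply hg; rw [hc, hd0]; ring
    have hq' : q' = 0 := by
      rw [hd0, mul_zero, add_zero] at hU13
      exact (mul_eq_zero.1 hU13).resolve_left hb
    have h3 : a * t * t' = 0 := by
      have : a * c * t * t' = 0 := by rw [hd0] at hD'; simpa using hD'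
      have : c * (a * t * t') = 0 := by linear_combination this
      exact (mul_eq_zero.1 this).resolve_left hc
    refine Or.inr (Or.inl ⟨hd0, hq', ?_⟩)
    rcases mul_eq_zero.1 h3 with h | h
    · rcases mul_eq_zero.1 h with h | h
      · exact Or.inl h
      · exact Or.inr (Or.inl h)
    · exact Or.inr (Or.inr h)

/-- **Residual case, same column and same row** (`U₀₂ = U₁₂ = 0`, `U'₀₂ = U'₁₂ = 0`): `TL` has
`ad = bc` with all entries nonzero, `D = 0` and `D' = 0` give `p'd = bq'` and `s'd = ct'`, the block
`BR` (expressed through the pivot minors) satisfies `m₂₂ = m₃₂ = m₂₃ = 0` and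
`dg·m₃₃ = −4 bc q't'`, and the minor `per[023 | 023] = p s m₃₃` forces `q't' = 0`, contradicting the
nonvanishing of the top of column `3` or the left of row `3`.
[cite: AlperBogartVelasco2017, §1 (sentence introducing Cor. 1.4), arXiv text p0003 L38] -/
theorem false_of_same {a b c d p q p' q' s t s' t' m₂₂ m₂₃ m₃₂ m₃₃ : L} (h2 : (2 : L) ≠ 0)
    (hg : a * d + b * c ≠ 0)
    (hU02 : a * q + p * c = 0) (hU12 : b * q + p * d = 0)
    (hU'02 : a * t + s * b = 0) (hU'12 : c * t + s * d = 0)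
    (hD : a * b * q * q' + p * p' * c * d = 0)
    (hD' : a * c * t * t' + s * s' * b * d = 0)
    (hm22 : m₂₂ * (a * d + b * c) + s * (b * q + p * d) + t * (a * q + p * c) = 0)
    (hm23 : m₂₃ * (a * d + b * c) + s * (b * q' + p' * d) + t * (a * q' + p' * c) = 0)
    (hm32 : m₃₂ * (a * d + b * c) + s' * (b * q + p * d) + t' * (a * q + p * c) = 0)
    (hm33 : m₃₃ * (a * d + b * c) + s' * (b * q' + p' * d) + t' * (a * q' + p' * c) = 0)
    (hA : a * (m₂₂ * m₃₃ + m₂₃ * m₃₂) + p * (s * m₃₃ + m₂₃ * s') + p' * (s * m₃₂ + m₂₂ * s') = 0)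
    (hc2 : ¬ (p = 0 ∧ q = 0)) (hc3 : ¬ (p' = 0 ∧ q' = 0)) (hr2 : ¬ (s = 0 ∧ t = 0))
    (hr3 : ¬ (s' = 0 ∧ t' = 0)) : False := by
  have h4 : (4 : L) ≠ 0 := by
    rw [show (4 : L) = 2 * 2 by norm_num]; exact mul_ne_zero h2 h2
  -- `ad = bc`, all of `a, b, c, d` nonzero
  have hdetp : (a * d - b * c) * p = 0 := by linear_combination a * hU12 - b * hU02
  have hdetq : (a * d - b * c) * q = 0 := by linear_combination d * hU02 - c * hU12
  have hdet : a * d - b * c = 0 := by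
    by_contra h
    exact hc2 ⟨(mul_eq_zero.1 hdetp).resolve_left h, (mul_eq_zero.1 hdetq).resolve_left h⟩
  have had : a * d ≠ 0 := by
    intro h0; apply hg; linear_combination 2 * h0 - hdet
  have ha : a ≠ 0 := left_ne_zero_of_mul had
  have hd : d ≠ 0 := right_ne_zero_of_mul had
  have hbc : b * c ≠ 0 := by
    intro h0; apply had; linear_combination hdet + h0
  have hb : b ≠ 0 := left_ne_zero_of_mul hbc
  have hc : c ≠ 0 := right_ne_zero_of_mul hbc
  -- `p, q, s, t` nonzero
  have hp : p ≠ 0 := by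
    intro hp; apply hc2; refine ⟨hp, ?_⟩
    rw [hp, zero_mul, add_zero] at hU02
    exact (mul_eq_zero.1 hU02).resolve_left ha
  have hs : s ≠ 0 := by
    intro hs; apply hr2; refine ⟨hs, ?_⟩
    rw [hs, zero_mul, add_zero] at hU'02
    exact (mul_eq_zero.1 hU'02).resolve_left ha
  -- `p'd = bq'` and `s'd = ct'`
  have hpd : p * c * (p' * d - b * q') = 0 := by
    linear_combination hD - (b * q') * hU02
  have hpd' : p' * d - b * q' = 0 := (mul_eq_zero.1 hpd).resolve_left (mul_ne_zero hp hc)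
  have hsd : s * b * (s' * d - c * t') = 0 := by
    linear_combination hD' - (c * t') * hU'02
  have hsd' : s' * d - c * t' = 0 := (mul_eq_zero.1 hsd).resolve_left (mul_ne_zero hs hb)
  -- the block entries
  have hm22' : m₂₂ = 0 := by
    rw [hU02, hU12, mul_zero, mul_zero, add_zero, add_zero] at hm22
    exact (mul_eq_zero.1 hm22).resolve_right hg
  have hm32' : m₃₂ = 0 := by
    rw [hU02, hU12, mul_zero, mul_zero, add_zero, add_zero] at hm32
    exact (mul_eq_zero.1 hm32).resolve_right hg
  have hm23' : m₂₃ = 0 := by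
    have h : d * (m₂₃ * (a * d + b * c)) = 0 := by
      linear_combination d * hm23 - (2 * b * q') * hU'12 - (d * s + t * c) * hpd' - (t * q') * hdet
    rcases mul_eq_zero.1 h with h | h
    · exact absurd h hd
    · exact (mul_eq_zero.1 h).resolve_right hg
  have hm33' : m₃₃ = 0 := by
    rw [hm22', hm32', hm23'] at hA
    have h : p * s * m₃₃ = 0 := by linear_combination hA
    exact (mul_eq_zero.1 h).resolve_left (mul_ne_zero hp hs)
  -- `dg·m₃₃ = -4bc q't'`, and `m₃₃ = 0`
  have hkey : 4 * (b * c) * (q' * t') = 0 := by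
    have e := hm33
    rw [hm33', zero_mul, zero_add] at e
    linear_combination d * e - (2 * b * q') * hsd' - (d * s' + t' * c) * hpd' - (t' * q') * hdet
  have hqt : q' * t' = 0 := (mul_eq_zero.1 hkey).resolve_left (mul_ne_zero h4 hbc)
  rcases mul_eq_zero.1 hqt with hq' | ht'
  · apply hc3
    refine ⟨?_, hq'⟩
    have : p' * d = 0 := by linear_combination hpd' + b * hq'
    exact (mul_eq_zero.1 this).resolve_right hd
  · apply hr3
    refine ⟨?_, ht'⟩
    have : s' * d = 0 := by linear_combination hsd' + c * ht'
    exact (mul_eq_zero.1 this).resolve_right hd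

end AlperBogartVelasco

end Literature.Computability.AlgebraicComplexity
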